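import Summits.BirchSwinnertonDyer.BirchSwinnertonDyer.Theses.PrintCf2
import HarnessLib

/-!
# Route `PrintCf2`, item stmt-BirchSwinnertonDyer-20510 `RamifiedTwoRankOneOfFactsGlue` — CLOSED (cell `bsd-print-cf2`, p1)

HONEST FRAMING (cell `bsd-print-cf2`, run/shared/lean/pub/bsd-print-cf2/; route `PrintCf2`, leaf CornerF @ `p = 2` =
`WAllCornerFTwo`, OPEN AS A CLASS): a CLOSING file — it imports the route file and proves ONE item whose statement
carries its published inputs as an antecedent (facts-relative «OfFacts» typing; nothing asserted, no named fact
introduced). The mathematics is in the seat's W-ALL files `Rank1Residual/WAll/TargetCMTwoRamifiedFamilies.lean`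
(p533515), `…/AltClosersCMTwoRamifiedFamilies.lean` (p535702), `…/TargetCMTwoRamifiedOffTYZProved.lean` (p536500),
`…/AltClosersCMTwoRamifiedGenusClass.lean` (p538378); here only the one-line term. Strategy sentence (p1): «Tian–Yuan–Zhang
induction BY NAME … 2-part of BSD for E_n with controlled prime factorisations, typed as class theorems on explicit
infinite families».

THE ITEM (GLUE of the LAYER-2 split of crux 20362): `RamifiedTYZFamiliesOfFacts → RamifiedOffTYZOfFacts →
RamifiedTwoRankOneOfFacts` — granted 𝔅_ram, ON the proved TYZ families ∧ OFF them ⟹ the whole ramified type, by the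
exact two-way cut `wAllCornerFTwoRamified_of_tyzProved_of_offTYZProved` (p536500; excluded middle on membership in
`CongruentTYZProvedFamily`). Pure logic; beyond print: n/a. [cite: Miller2011LMS, §1 and Def. 1.1]
-/

noncomputable section

open scoped Classical

open Summit.BirchSwinnertonDyer
open Summit.BirchSwinnertonDyer.BirchSwinnertonDyer.Theses.PrintCf2

set_option autoImplicit false
-- `Summit.BirchSwinnertonDyer.BirchSwinnertonDyer.Theorems` is the layout's namespace (Sub = Summit name).
set_option linter.dupNamespace false

namespace Summit.BirchSwinnertonDyer.BirchSwinnertonDyer.Theorems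

/-- **Item 20510 (glue) holds**: children ⟹ parent, `fun hT hO hB ↦ (ON hB) ∪ (OFF hB)`. [folklore] -/
theorem ramifiedTwoRankOneOfFactsGlue_proof : RamifiedTwoRankOneOfFactsGlue :=
  fun hT hO hB ↦ wAllCornerFTwoRamified_of_tyzProved_of_offTYZProved (hT hB) (hO hB)

end Summit.BirchSwinnertonDyer.BirchSwinnertonDyer.Theorems

end
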